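import Summits.HodgeConjecture.HodgeConjecture.Theorems.CyclicUnitaryPowersSpectralProjectors

/-!
# The perfect pairing between opposite eigenspaces `E_j`, `E_{p-j}` of a finite-order isometry

Shared eigenblock helper for the crux `PowersHodgeOfDeckCommutators` (stmt-HodgeConjecture-19545, route
`CyclicUnitaryPowers`, line `unitary-kunneth-fft` v5, lane 2 stubs D₂ `stub_deckUnitaryCommutatorGeneration`
(the `Q`-dual extension of a block automorphism) and L `stub_deckUnitaryInvariantsMatching` (adapted dual bases)).
For `σ ^ p = 1` over a field `K` of characteristic zero with a primitive root `ζ`, and a NONDEGENERATE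
`σ`-invariant bilinear form `B` on the finite-dimensional `W`, with `E_j = range P_j` the `ζ^j`-eigenspace:

* `eigenPairing j : E_{p-j} →ₗ Dual K E_j`, `y ↦ (x ↦ B x y)`, and `eigenPairing' j : E_j →ₗ Dual K E_{p-j}`,
  `x ↦ (y ↦ B x y)`;
* both are injective (`eigenPairing_injective`, `eigenPairing'_injective`: a vector of `E_{p-j}` orthogonal to
  `E_j` is orthogonal to everything, by the orthogonality of eigencomponents), hence
  `finrank E_j = finrank E_{p-j}` (`finrank_eigenblock_eq`) and both are isomorphisms (`eigenPairingEquiv`);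
* `eq_of_forall_apply_eigenblock` — two vectors of `E_{p-j}` with the same pairings against `E_j` are equal;
* `centraliser_ext_of_eq_on` — two `σ`-commuting `B`-isometries that agree on `E_j` agree on `E_{p-j}`.
-/

noncomputable section

open Module
open scoped BigOperators

namespace Summit.HodgeConjecture.HodgeConjecture.Theorems.CyclicUnitaryPowersEigenPairing

open Summit.HodgeConjecture.HodgeConjecture.Theorems.CyclicUnitaryPowersSpectralProjectors

variable {K : Type*} [Field K] [CharZero K] {W : Type*} [AddCommGroup W] [Module K W]
variable {σ : W →ₗ[K] W} {ζ : K} {p : ℕ} {B : LinearMap.BilinForm K W}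

/-- The eigenblock `E_j := range P_j` (the `ζ^j`-eigenspace of `σ`, `range_specProj`). [folklore] -/
abbrev E (σ : W →ₗ[K] W) (ζ : K) (p j : ℕ) : Submodule K W := LinearMap.range (specProj σ ζ p j)

/-- A vector of `E_l` orthogonal to `E_k` with `k + l ≡ 0 (mod p)`, `k < p`, is right-orthogonal to all of `W`.
[folklore] -/
theorem apply_eq_zero_of_forall_eigenblock (hσ : σ ^ p = 1) (hζ : IsPrimitiveRoot ζ p) (hp : 0 < p)
    (hB : ∀ x y, B (σ x) (σ y) = B x y) {k l : ℕ} (hk : k < p) (hkl : p ∣ k + l) {y : W} (hy : y ∈ E σ ζ p l)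
    (h : ∀ x ∈ E σ ζ p k, B x y = 0) (w : W) : B w y = 0 := by
  obtain ⟨y', rfl⟩ := hy
  conv_lhs => rw [← sum_specProj_apply (σ := σ) hζ hp w]
  rw [map_sum, LinearMap.sum_apply]
  refine Finset.sum_eq_zero fun m hm => ?_
  by_cases hmk : m = k
  · subst hmk
    exact h _ ⟨w, rfl⟩
  · -- `m + l ≢ 0 (mod p)` since `m ≠ k`, `m, k < p`, `k + l ≡ 0`
    have hm' := Finset.mem_range.mp hm
    have hndvd : ¬ p ∣ m + l := by
      intro hml
      have h1 : (p : ℤ) ∣ (m : ℤ) - k := by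
        have h2 : (p : ℤ) ∣ ((m + l : ℕ) : ℤ) - ((k + l : ℕ) : ℤ) :=
          dvd_sub (Int.natCast_dvd_natCast.mpr hml) (Int.natCast_dvd_natCast.mpr hkl)
        push_cast at h2
        have e : (m : ℤ) + l - (k + l) = m - k := by ring
        rwa [e] at h2
      obtain ⟨c, hc⟩ := h1
      have hlt : |(m : ℤ) - k| < p := by rw [abs_sub_lt_iff]; constructor <;> omega
      rw [hc, abs_mul, Nat.abs_cast] at hlt
      have hc0 : c = 0 := by
        by_contra hne
        have h1 : (1 : ℤ) ≤ |c| := Int.one_le_abs hne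
        nlinarith [h1, hlt, (show (0 : ℤ) < p by exact_mod_cast hp)]
      rw [hc0, mul_zero, sub_eq_zero] at hc
      exact hmk (by exact_mod_cast hc)
    exact apply_specProj_specProj_eq_zero hσ hζ hp hB hndvd w y'

/-- Symmetric version: a vector of `E_k` left-orthogonal to `E_l` (`k + l ≡ 0`, `l < p`) is left-orthogonal to
all of `W`. [folklore] -/
theorem apply_eq_zero_of_forall_eigenblock' (hσ : σ ^ p = 1) (hζ : IsPrimitiveRoot ζ p) (hp : 0 < p)
    (hB : ∀ x y, B (σ x) (σ y) = B x y) {k l : ℕ} (hl : l < p) (hkl : p ∣ k + l) {x : W} (hx : x ∈ E σ ζ p k)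
    (h : ∀ y ∈ E σ ζ p l, B x y = 0) (w : W) : B x w = 0 := by
  obtain ⟨x', rfl⟩ := hx
  conv_lhs => rw [← sum_specProj_apply (σ := σ) hζ hp w]
  rw [map_sum]
  refine Finset.sum_eq_zero fun m hm => ?_
  by_cases hml : m = l
  · subst hml
    exact h _ ⟨w, rfl⟩
  · have hm' := Finset.mem_range.mp hm
    have hndvd : ¬ p ∣ k + m := by
      intro hkm
      have h1 : (p : ℤ) ∣ (m : ℤ) - l := by
        have h2 : (p : ℤ) ∣ ((k + m : ℕ) : ℤ) - ((k + l : ℕ) : ℤ) :=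
          dvd_sub (Int.natCast_dvd_natCast.mpr hkm) (Int.natCast_dvd_natCast.mpr hkl)
        push_cast at h2
        have e : (k : ℤ) + m - (k + l) = m - l := by ring
        rwa [e] at h2
      obtain ⟨c, hc⟩ := h1
      have hlt : |(m : ℤ) - l| < p := by rw [abs_sub_lt_iff]; constructor <;> omega
      rw [hc, abs_mul, Nat.abs_cast] at hlt
      have hc0 : c = 0 := by
        by_contra hne
        have h1 : (1 : ℤ) ≤ |c| := Int.one_le_abs hne
        nlinarith [h1, hlt, (show (0 : ℤ) < p by exact_mod_cast hp)]
      rw [hc0, mul_zero, sub_eq_zero] at hc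
      exact hml (by exact_mod_cast hc)
    exact apply_specProj_specProj_eq_zero hσ hζ hp hB hndvd x' w

/-- **The pairing** `E_l → Dual E_k`, `y ↦ (x ↦ B x y)`. [folklore] -/
def eigenPairing (B : LinearMap.BilinForm K W) (σ : W →ₗ[K] W) (ζ : K) (p k l : ℕ) :
    E σ ζ p l →ₗ[K] Module.Dual K (E σ ζ p k) where
  toFun y := (B.flip (y : W)).comp (E σ ζ p k).subtype
  map_add' y y' := by ext x; simp
  map_smul' c y := by ext x; simp

omit [CharZero K] in
/-- Unfolding lemma. [folklore] -/
@[simp] theorem eigenPairing_apply (k l : ℕ) (y : E σ ζ p l) (x : E σ ζ p k) :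
    eigenPairing B σ ζ p k l y x = B (x : W) (y : W) := rfl

/-- **The pairing in the other variable** `E_k → Dual E_l`, `x ↦ (y ↦ B x y)`. [folklore] -/
def eigenPairing' (B : LinearMap.BilinForm K W) (σ : W →ₗ[K] W) (ζ : K) (p k l : ℕ) :
    E σ ζ p k →ₗ[K] Module.Dual K (E σ ζ p l) where
  toFun x := (B (x : W)).comp (E σ ζ p l).subtype
  map_add' x x' := by ext y; simp
  map_smul' c x := by ext y; simp

omit [CharZero K] in
/-- Unfolding lemma. [folklore] -/
@[simp] theorem eigenPairing'_apply (k l : ℕ) (x : E σ ζ p k) (y : E σ ζ p l) :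
    eigenPairing' B σ ζ p k l x y = B (x : W) (y : W) := rfl

/-- The pairing `E_l → Dual E_k` is injective (`B` nondegenerate, `k + l ≡ 0`, `k < p`). [folklore] -/
theorem eigenPairing_injective (hσ : σ ^ p = 1) (hζ : IsPrimitiveRoot ζ p) (hp : 0 < p)
    (hB : ∀ x y, B (σ x) (σ y) = B x y) (hBn : B.Nondegenerate) {k l : ℕ} (hk : k < p) (hkl : p ∣ k + l) :
    Function.Injective (eigenPairing B σ ζ p k l) := by
  rw [← LinearMap.ker_eq_bot, Submodule.eq_bot_iff]
  intro y hy
  rw [LinearMap.mem_ker] at hy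
  have h : ∀ x ∈ E σ ζ p k, B x (y : W) = 0 := fun x hx => by
    have := congrArg (fun φ : Module.Dual K (E σ ζ p k) => φ ⟨x, hx⟩) hy
    simpa using this
  have hy0 : (y : W) = 0 := hBn.2 _ (fun w => apply_eq_zero_of_forall_eigenblock hσ hζ hp hB hk hkl y.2 h w)
  exact Subtype.ext hy0

/-- The pairing `E_k → Dual E_l` is injective (`B` nondegenerate, `k + l ≡ 0`, `l < p`). [folklore] -/
theorem eigenPairing'_injective (hσ : σ ^ p = 1) (hζ : IsPrimitiveRoot ζ p) (hp : 0 < p)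
    (hB : ∀ x y, B (σ x) (σ y) = B x y) (hBn : B.Nondegenerate) {k l : ℕ} (hl : l < p) (hkl : p ∣ k + l) :
    Function.Injective (eigenPairing' B σ ζ p k l) := by
  rw [← LinearMap.ker_eq_bot, Submodule.eq_bot_iff]
  intro x hx
  rw [LinearMap.mem_ker] at hx
  have h : ∀ y ∈ E σ ζ p l, B (x : W) y = 0 := fun y hy => by
    have := congrArg (fun φ : Module.Dual K (E σ ζ p l) => φ ⟨y, hy⟩) hx
    simpa using this
  have hx0 : (x : W) = 0 := hBn.1 _ (fun w => apply_eq_zero_of_forall_eigenblock' hσ hζ hp hB hl hkl x.2 h w)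
  exact Subtype.ext hx0

variable [FiniteDimensional K W]

/-- **Opposite eigenblocks have the same dimension** (`k + l ≡ 0`, `k, l < p`). [folklore] -/
theorem finrank_eigenblock_eq (hσ : σ ^ p = 1) (hζ : IsPrimitiveRoot ζ p) (hp : 0 < p)
    (hB : ∀ x y, B (σ x) (σ y) = B x y) (hBn : B.Nondegenerate) {k l : ℕ} (hk : k < p) (hl : l < p)
    (hkl : p ∣ k + l) : Module.finrank K (E σ ζ p k) = Module.finrank K (E σ ζ p l) := by
  apply le_antisymm
  · have h := LinearMap.finrank_le_finrank_of_injective (eigenPairing'_injective hσ hζ hp hB hBn hl hkl)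
    rwa [Subspace.dual_finrank_eq] at h
  · have h := LinearMap.finrank_le_finrank_of_injective (eigenPairing_injective hσ hζ hp hB hBn hk hkl)
    rwa [Subspace.dual_finrank_eq] at h

/-- **The pairing is perfect**: `E_l ≃ Dual E_k`. [folklore] -/
def eigenPairingEquiv (hσ : σ ^ p = 1) (hζ : IsPrimitiveRoot ζ p) (hp : 0 < p)
    (hB : ∀ x y, B (σ x) (σ y) = B x y) (hBn : B.Nondegenerate) {k l : ℕ} (hk : k < p) (hl : l < p)
    (hkl : p ∣ k + l) : E σ ζ p l ≃ₗ[K] Module.Dual K (E σ ζ p k) :=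
  LinearMap.linearEquivOfInjective (eigenPairing B σ ζ p k l) (eigenPairing_injective hσ hζ hp hB hBn hk hkl)
    (by rw [Subspace.dual_finrank_eq, finrank_eigenblock_eq hσ hζ hp hB hBn hk hl hkl])

/-- Unfolding lemma for the perfect pairing. [folklore] -/
@[simp] theorem eigenPairingEquiv_apply (hσ : σ ^ p = 1) (hζ : IsPrimitiveRoot ζ p) (hp : 0 < p)
    (hB : ∀ x y, B (σ x) (σ y) = B x y) (hBn : B.Nondegenerate) {k l : ℕ} (hk : k < p) (hl : l < p)
    (hkl : p ∣ k + l) (y : E σ ζ p l) (x : E σ ζ p k) :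
    eigenPairingEquiv hσ hζ hp hB hBn hk hl hkl y x = B (x : W) (y : W) := rfl

omit [FiniteDimensional K W] in
/-- Two vectors of `E_l` with the same pairings against `E_k` are equal. [folklore] -/
theorem eq_of_forall_apply_eigenblock (hσ : σ ^ p = 1) (hζ : IsPrimitiveRoot ζ p) (hp : 0 < p)
    (hB : ∀ x y, B (σ x) (σ y) = B x y) (hBn : B.Nondegenerate) {k l : ℕ} (hk : k < p) (hkl : p ∣ k + l)
    {y y' : W} (hy : y ∈ E σ ζ p l) (hy' : y' ∈ E σ ζ p l) (h : ∀ x ∈ E σ ζ p k, B x y = B x y') : y = y' := by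
  have hinj := eigenPairing_injective hσ hζ hp hB hBn hk hkl
  have heq : eigenPairing B σ ζ p k l ⟨y, hy⟩ = eigenPairing B σ ζ p k l ⟨y', hy'⟩ := by
    ext x
    simpa using h x x.2
  exact congrArg Subtype.val (hinj heq)

omit [FiniteDimensional K W] in
/-- **Isometries in the centraliser are determined blockwise by duality**: two `σ`-commuting `B`-isometric
automorphisms that agree on `E_k` agree on `E_l` (`k + l ≡ 0`, `k < p`). [folklore] -/
theorem centraliser_ext_of_eq_on (hσ : σ ^ p = 1) (hζ : IsPrimitiveRoot ζ p) (hp : 0 < p)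
    (hB : ∀ x y, B (σ x) (σ y) = B x y) (hBn : B.Nondegenerate) {k l : ℕ} (hk : k < p) (hkl : p ∣ k + l)
    {γ γ' : W ≃ₗ[K] W} (hγσ : ∀ x, γ (σ x) = σ (γ x)) (hγ'σ : ∀ x, γ' (σ x) = σ (γ' x))
    (hγB : ∀ x y, B (γ x) (γ y) = B x y) (hγ'B : ∀ x y, B (γ' x) (γ' y) = B x y)
    (heq : ∀ x ∈ E σ ζ p k, γ x = γ' x) {y : W} (hy : y ∈ E σ ζ p l) : γ y = γ' y := by
  -- `γ`, `γ'` preserve every eigenblock (they commute with `σ`, hence with `P_m`)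
  have hpres : ∀ (δ : W ≃ₗ[K] W), (∀ x, δ (σ x) = σ (δ x)) → ∀ m, ∀ z ∈ E σ ζ p m, δ z ∈ E σ ζ p m := by
    intro δ hδ m z hz
    have hc : (δ : W →ₗ[K] W) * σ = σ * (δ : W →ₗ[K] W) := by ext x; exact hδ x
    exact mapsTo_range_of_commute (commute_specProj (ζ := ζ) (p := p) (δ : W →ₗ[K] W) hc m) z hz
  -- the inverses agree on `E_k` as well
  have hsurj : ∀ x ∈ E σ ζ p k, ∃ x' ∈ E σ ζ p k, γ x' = x := by
    intro x hx
    -- `γ` restricted to the finite-dimensional?  No: use `γ.symm x`, which lies in `E_k` since `γ.symm` commutes with `σ`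
    refine ⟨γ.symm x, ?_, γ.apply_symm_apply x⟩
    have hδ : ∀ z, γ.symm (σ z) = σ (γ.symm z) := fun z => by
      apply γ.injective; rw [γ.apply_symm_apply, hγσ, γ.apply_symm_apply]
    exact hpres γ.symm hδ k x hx
  refine eq_of_forall_apply_eigenblock hσ hζ hp hB hBn hk hkl (hpres γ hγσ _ y hy) (hpres γ' hγ'σ _ y hy) ?_
  intro x hx
  obtain ⟨x', hx', rfl⟩ := hsurj x hx
  rw [hγB, heq x' hx', hγ'B]

end Summit.HodgeConjecture.HodgeConjecture.Theorems.CyclicUnitaryPowersEigenPairing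

end
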